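import Summits.Ventures.CertifiedManyBodySolver.Certificates.SymRungV0core.Defs

/-!
# Rung V = v0′ — well-formedness of the expanded certificate (`hwf` of the closing).
No bound of record moves by this module (#529 −0.8295699476 stays the certified row); the rung value −0.8942613 is 0.064 BELOW the −83/100 edge (stmt-Ventures-22024 NOT closed); computational grade (`native_decide`); no summit or crux statement is proved here; nothing here predicts superconductivity.
-/

namespace Summit.Ventures.CertifiedManyBodySolver.Certificates.SymRungV0core

open Summit.Ventures.CertifiedManyBodySolver.Theorems.SymReplay

/-- The expanded certificate (R-blocks generated into Gram blocks) is well formed. -/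
theorem hwf : wellFormed cert.expand = true := by native_decide

end Summit.Ventures.CertifiedManyBodySolver.Certificates.SymRungV0core
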